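import Summits.QuantumFields.YangMills.Theorems.BalabanUVNodesN11Sect3SupplyChainBorelBOfBgFacts
import Summits.QuantumFields.YangMills.Theorems.BalabanUVNodesN11Sect3SupplyChainBorelBThm1PrintedOfSolvable

/-!
# DAG node N11 — N11's PRINTED OUTPUT `B16.Thm1Printed` ON THE BorelB ROAD WITH THE RUN-GUARD BINDER DROPPED: this seat's B §5 printed faces (p607924) with
# `hPC : ∀ P, window → PartCompat₁₃ θ P P.K` (unsatisfiable, dag-n11-w4 g4) REPLACED by the bg FACTS of the windowed runs `∀ P, window → ∀ k ≤ K, BgProvisoΛ … k …`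
# (satisfiable: dag-n11-w5 g2 p623895 §6 at K1's witness H-extensions) + `L·M₂ ∣ M`, `M = L^a` — generic certificate, K1-keyed datum, named certificate `gaussPinH θ`

HEADER — WORK-UNIT METADATA.  Cell `pub-ymgap`, YM-PLAN Track A (HUMAN RULING D-0062 ∕ D-0149 width seats), seat `pub-ymgap-dag-n11-w1` (g3; WIDTH SEAT 1 of 4 on NODE n11
[B14]), route `BalabanUVNodes` rev 27 (Variant R), KEY item K1⁸ `StabilityBRunRowsAtRecordR13SepCoPH` = stmt-QuantumFields-26907 (helper lane, `--kind proof --supports 26907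
--as helper`, count-neutral).  Fourth file of dag-n11-d g15's HAND-OUT (o5) ∕ dag-n11-w4 g4's READING NOTE (b) (pub-ymgap INBOX 2026-08-28T10:17Z: «then n11-w1's printed faces may
DROP `hPC` altogether»).  [III] = [Balaban1988Convergent], [V] = [Balaban1989LargeFieldII], [IV] = [Balaban1989LargeFieldI], [15] = [Balaban1985Variational].  Over this seat's
`…Sect3SupplyChainBorelBOfBgFacts` (H3: `noExpansionObligation_of_gaussCert_of_supplierBorel_of_bgFacts_of_powM`), `…BorelBThm1PrintedOfSolvable` (p607924: `provisos₁₃SepCoPH_gaussPinH`,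
`step_inInterval_top_of_flow_inInterval_min`), g0's `…GaussianCertificateDefs` (`gaussPinH`, `gaussPinH_ζ0 ∕ _quad`), dag-n11-e's `…Sect3SupplyChainNode` (p596032:
`thm1Printed_datumOfRecord₁₃CoPH_of_obligations`), def-T's `Node00/Record13(SepCoPH)` (`datumOfRecord₁₃CoPH ∕ SepCoPH`, `BgProvisoΛ`).

WHY THIS FILE.  This seat's files B–E typed N11's printed output `B16.Thm1Printed (datum θ).C` on the BorelB road under the binder `∀ P, window γ P → PartCompat₁₃ θ P P.K`, which
dag-n11-w4 g4 proved UNSATISFIABLE at every `γ` (tiny bare couplings stay in the window and leave the last 𝐃-cube bigger than the torus) — so B–E's printed faces were vacuous by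
antecedent (A6), as every header since said.  The plan (g85 WORD-2) priced the hole as SCOPE∕SUPPLY, road (α): below the floor the partition of record is ONE-BLOCK and what the
no-expansion 𝐓-step really reads is the background-regularity CONTENT of row P11, level by level — now PRODUCED without any run guard (dag-n11-w4 `…N11BgRowOfPowM` ∕ dag-n11-w5
p623895 `…N11BgRowGaugeROfHcubeOmega` §6: `∀ n ≤ K` on window runs, at K1's witness H-extensions with `j + 1 ≤ m`) and CONSUMED without any run guard by this seat's H1–H3.  THIS
FILE closes the loop on the printed face: B §5's three printed theorems with `hPC` (and the cover binder `hcov`) REPLACED by `hbgs` + `L·M₂ ∣ M` + `M = L^a`, the key weakened to the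
core where the datum allows (CoPH edition).  Every displayed binder of N11's printed face on this road is now satisfiable IN KIND — which does not make any of them proved here.

WHAT THIS FILE PROVES (3 theorems, 0 `def`, 0 `sorry`; standard axioms; compositions BY NAME).
★★★★ `thm1Printed_datumOfRecord₁₃CoPH_of_gaussCert_of_supplierBorel_of_bgFacts_of_powM` · ★★★★ `thm1Printed_datumOfRecord₁₃SepCoPH_of_gaussCert_of_supplierBorel_of_bgFacts_of_powM` ·
★★★★★ `thm1Printed_datumOfRecord₁₃SepCoPH_gaussPinH_of_supplierBorel_of_bgFacts_of_powM`.

HONEST FRAMING.  Helper lane of K1⁸, count-neutral kernel bookkeeping; the bg facts ([III] (2.28) ∕ [15] Thm 1 content — dag-n11-w5's §6 supplies them from DISPLAYED [15] letters,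
not proved), K0's per-cube solvability, `2 ≤ cR` (uninhabited at the `c := 1` witnesses), the numerics, [III] §3's supplier (`SupplierObligations ∧ SupplierBorel` — XL, nobody's
theorem) are DISPLAYED HYPOTHESES; nothing of Bałaban asserted.  N11 NOT discharged; K1⁸ ∕ K1⁷ NOT closed, no registered stub touched; counts unmoved (typed 28∕28 · discharged 5∕27).
One finite `𝕋⁴_{L^K}` programme at fixed `ε = L^{−K}`; R4 closes only the conditional finite-𝕋⁴ rung `BalabanLadder.UV` — NOT ℝ⁴, NOT OS, NOT a mass gap, NOT Clay.  No `sorry`, no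
`axiom`, no `def`, no `instance`, no `notation`.
Sources (SHAPE only): [III] Thm 1 p.262, Theorem p.245, §3 p.279, (0.2) p.244, (2.5) p.255, (2.28) p.259, p.257, (3.16) p.268, (3.24)–(3.25) p.270; [V] Thm 1 p.355; [IV] (0.3)–(0.4)
p.176, p.177 (i)–(ii); [15] Thm 1 (7)–(8) pp.278–279.
-/

noncomputable section

open MeasureTheory
open scoped BigOperators ENNReal NNReal Matrix.Norms.L2Operator

namespace Summit.QuantumFields.YangMills.Theorems.BalabanUVNodesN11Sect3SupplyChainBorelBThm1PrintedOfBgFacts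

open Literature.MathematicalPhysics.QuantumFieldTheory.Balaban1983to89 T4Continuum T4NestedCovariance Node00 Node00.Tk DagBinding
open B15DeterminingSets B8Eq17ClassAkV1 B14.Eq218Concrete B10Eq42TorusConstraint Step
open B14.Eq213MaximalDomains (side)
open B14.Eq213DetSet (Bj)
open Literature.MathematicalPhysics.QuantumFieldTheory.BalabanImbrieJaffe1984to88.BIJ85Eq453GaugeField (qsstarGIter0)
open BalabanUVNodesN11HistoryPinnedResidualDefs BalabanUVNodesN11RePinnedParamDefs
open BalabanUVNodesN11GaussianCertificateRows
open BalabanUVNodesN11GaussianCertificateDefs (gaussPinH gaussPinH_ζ0 gaussPinH_quad provisos₁₃CoPH_gaussPinH)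
open BalabanUVNodesN11Sect3SupplyChainDefs
open BalabanUVNodesN11Sect3SupplyChainBorelB
open BalabanUVNodesN11Sect3SupplyChainObligationsDefs
open BalabanUVNodesN11Sect3SupplyChainNode (thm1Printed_datumOfRecord₁₃CoPH_of_obligations)
open BalabanUVNodesN11Sect3SupplyChainBorelBObligationsOfSolvable
open BalabanUVNodesN11Sect3SupplyChainBorelBThm1PrintedOfSolvable (provisos₁₃SepCoPH_gaussPinH step_inInterval_top_of_flow_inInterval_min)
open BalabanUVNodesN11Sect3SupplyChainBorelBOfBgFacts (noExpansionObligation_of_gaussCert_of_supplierBorel_of_bgFacts_of_powM)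

variable {F : T4Family} {N : ℕ} [NeZero N]

section Printed

variable (θ : Stage13HParams F N)

/-- **★★★★ N11's PRINTED OUTPUT `B16.Thm1Printed` AT THE CoPH DATUM OF A GAUSSIAN-CLASS `θ` WITH THE RUN-GUARD BINDER DROPPED** — this seat's B §5
`thm1Printed_datumOfRecord₁₃CoPH_of_gaussCert_of_supplierBorel_of_solvable` (p607924) with its binder `hPC : ∀ P, window γ P → PartCompat₁₃ θ P P.K` — UNSATISFIABLE at every `γ`
(dag-n11-w4 g4 p615408 ∕ p617030) — REPLACED by the bg FACTS of the windowed runs `hbgs : ∀ P, window γ P → ∀ k ≤ P.K, BgProvisoΛ … k (suppOfRecord₁₃SepCoP …) (UbgOfRecord₁₃CoP …)`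
(SATISFIABLE: dag-n11-w5 g2 p623895 §6 produces exactly this family at the H-extensions of K1's witness of record with `j + 1 ≤ m`, one-block levels included via dag-n11-w4's
`hcubeΩ_of_powM`) plus `L·M₂ ∣ M`, `M = L^a` (the cover, dag-n11-w4 p618164), and the key weakened to the CORE `Provisos₁₃CoPH`.  Per windowed run the no-expansion obligation is this
seat's H3 `noExpansionObligation_of_gaussCert_of_supplierBorel_of_bgFacts_of_powM`; the assembly is dag-n11-e's `thm1Printed_datumOfRecord₁₃CoPH_of_obligations` (p596032).
Displayed besides: the certificate, the live-selector line, `0 < M₁ ≤ M`, `2 ≤ cR`, some `γ > 0`, and per run in `]0, γ]` the five numeric rows, K0's per-cube [15]-solvability and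
[III] §3's supplier with `SupplierObligations ∧ SupplierBorel`.  [cite: Balaban1988Convergent, Thm 1 p.262, Theorem p.245, §3 p.279, (0.2) p.244, (2.28) p.259, p.257, (3.24)–(3.25) p.270; Balaban1989LargeFieldII, Thm 1 p.355; Balaban1989LargeFieldI, (0.3)–(0.4) p.176, p.177 (i)–(ii); Balaban1985Variational, Thm 1 (7)–(8) pp.278–279] -/
theorem thm1Printed_datumOfRecord₁₃CoPH_of_gaussCert_of_supplierBorel_of_bgFacts_of_powM
    (hζ : ∀ (p : B12.RunParams) (n : ℕ) (Ω Λ : ℕ → Set (Site (F.P p.K) 0)), (θ.Zh p n Ω Λ).ζ0 = (ZhPinOfRecord₁₃ θ.toStage13Params p Ω Λ).ζ0)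
    (hq : ∀ (p : B12.RunParams) (n : ℕ) (Ω Λ : ℕ → Set (Site (F.P p.K) 0)) (j : ℕ) (Λ' : Set (Site (F.P p.K) 0)) (ω : MultiCfg (F.P p.K) (SU N) (FluctV N)),
      (θ.Zh p n Ω Λ).quad j Λ' ω = ∑ b ∈ (Set.toFinite (bondsIn j (Λ'ᶜ ∩ Ω (j + 1)))).toFinset, ‖(ω j).2 b‖ ^ 2)
    (h : θ.Provisos₁₃CoPH F N) (hsel : θ.ppSel = ppSelLiveOfRecord F N θ.ν θ.τ9 (EOfRecord₁₃ F N θ.toStage13Params) (wOfRecord₉ F N θ.toStage9Params))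
    (hθ : θ.Admissible F N) (hκ : 0 ≤ θ.s2.lf.κ) (hE₀ : 0 ≤ θ.s2.lf.E₀) (hB₀ : 0 ≤ θ.s2.lf.B₀)
    (hM₁ : 0 < θ.ν.M₁) (hle : θ.ν.M₁ ≤ θ.τ9.M) (hcR : 2 ≤ θ.s2.cR) {γ : ℝ} (hγ : 0 < γ)
    (hbgs : ∀ P : B12.RunParams, Step.InInterval γ P.K (gOfRecord₁₃ F N θ.toStage13Params P) → ∀ k, k ≤ P.K →
      BgProvisoΛ F N P.K (settingOfRecord₁₃ F N θ.toStage13Params P) (θ.Rz P.K) θ.τ9.M k (suppOfRecord₁₃SepCoP F N θ.toStage13Params P k)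
        (UbgOfRecord₁₃CoP F N θ.toStage13Params P k))
    (hdiv : F.L * θ.ν.M₂ ∣ θ.τ9.M) {a : ℕ} (hMa : θ.τ9.M = F.L ^ a)
    (h3 : ∀ P : B12.RunParams, Step.InInterval γ P.K (gOfRecord₁₃ F N θ.toStage13Params P) → ∀ j, 1 ≤ j → j ≤ P.K →
      3 * side (F.P P.K).L θ.ν.M₁ j ≤ cubeSide (F.P P.K).L θ.ν.M₂ (RkOfRecord (F.P P.K).L θ.ν.r (gOfRecord₁₃ F N θ.toStage13Params P j)) j)
    (hR : ∀ P : B12.RunParams, Step.InInterval γ P.K (gOfRecord₁₃ F N θ.toStage13Params P) → ∀ j, 1 ≤ j → j ≤ P.K →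
      (F.P P.K).L ^ j + (((F.P P.K).d + 4) * (F.P P.K).L + 2) * (∑ l ∈ Finset.range j, (F.P P.K).L ^ l) + 2 ≤
        cubeSide (F.P P.K).L θ.ν.M₂ (RkOfRecord (F.P P.K).L θ.ν.r (gOfRecord₁₃ F N θ.toStage13Params P j)) j)
    (hε : ∀ P : B12.RunParams, Step.InInterval γ P.K (gOfRecord₁₃ F N θ.toStage13Params P) → ∀ j, 1 ≤ j → j ≤ P.K →
      0 < epsOfRecord θ.ν (gOfRecord₁₃ F N θ.toStage13Params P) j)
    (hε3 : ∀ P : B12.RunParams, Step.InInterval γ P.K (gOfRecord₁₃ F N θ.toStage13Params P) → ∀ j, 1 ≤ j → j ≤ P.K →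
      (143 * (((((F.P P.K).d + 4 : ℕ) : ℝ)) ^ 2 / 4) ^ 2) * epsOfRecord θ.ν (gOfRecord₁₃ F N θ.toStage13Params P) j ≤ 1 / 3)
    (hε2 : ∀ P : B12.RunParams, Step.InInterval γ P.K (gOfRecord₁₃ F N θ.toStage13Params P) → ∀ j, 1 ≤ j → j ≤ P.K →
      2 * epsOfRecord θ.ν (gOfRecord₁₃ F N θ.toStage13Params P) j ≤ 2 * ExpMeanLog.deltaSU (Fin N) / ((((F.P P.K).d + 4) * (F.P P.K).L : ℕ) : ℝ) ^ 2)
    (hsolv : ∀ P : B12.RunParams, Step.InInterval γ P.K (gOfRecord₁₃ F N θ.toStage13Params P) → ∀ j, 1 ≤ j → j ≤ P.K →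
      ∀ (s : SeqOfRecord F θ.ν θ.τ9.M (gOfRecord₁₃ F N θ.toStage13Params P) P.K j) (V : GaugeField (F.P P.K) j (SU N)),
      chiSeqOfRecord F N θ.ν θ.τ9.M (gOfRecord₁₃ F N θ.toStage13Params P) P.K j s V ≠ 0 →
      ∀ a ∈ cubesIn (fun a : ↥(cubeIndices (F.P P.K) (cubeSide (F.P P.K).L θ.ν.M₂ (RkOfRecord (F.P P.K).L θ.ν.r (gOfRecord₁₃ F N θ.toStage13Params P j)) j)) =>
          cubeEnl (F.P P.K) (cubeSide (F.P P.K).L θ.ν.M₂ (RkOfRecord (F.P P.K).L θ.ν.r (gOfRecord₁₃ F N θ.toStage13Params P j)) j) a 0) (s.Ω j),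
        ∃ U₀, IsMinimizer (avOfRecord F N P.K) {U | PlaqSmall (θ.ν.εreg * (F.P P.K).eta j ^ 2) U}
          (Bj θ.ν.M₁ (cubeEnl (F.P P.K) (cubeSide (F.P P.K).L θ.ν.M₂ (RkOfRecord (F.P P.K).L θ.ν.r (gOfRecord₁₃ F N θ.toStage13Params P j)) j) a 4) j)
          (avgFamily (avOfRecord F N P.K) (qsstarGIter0 j V)) U₀)
    (σ : (P : B12.RunParams) → Sect3Supplier θ P) (hσ : ∀ P : B12.RunParams, Step.InInterval γ P.K (gOfRecord₁₃ F N θ.toStage13Params P) → SupplierObligations θ P (σ P))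
    (hσB : ∀ P : B12.RunParams, Step.InInterval γ P.K (gOfRecord₁₃ F N θ.toStage13Params P) → SupplierBorel θ P (σ P)) :
    B16.Thm1Printed (datumOfRecord₁₃CoPH F N θ h).C :=
  thm1Printed_datumOfRecord₁₃CoPH_of_obligations h hsel hθ hκ hE₀ hB₀ hθ.toStage9.2.2.2 (lt_min hγ hθ.toStage9.gamma_pos) σ
    (fun P hP => hσ P (step_inInterval_top_of_flow_inInterval_min θ h hP).1) fun P hP =>
    have hW := step_inInterval_top_of_flow_inInterval_min θ h hP
    noExpansionObligation_of_gaussCert_of_supplierBorel_of_bgFacts_of_powM θ P hζ hq h hθ hM₁ hle hcR hW.2 (hbgs P hW.1) hdiv hMa (h3 P hW.1) (hR P hW.1)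
      (hε P hW.1) (hε3 P hW.1) (hε2 P hW.1) (hsolv P hW.1) (σ P) (hσB P hW.1)

/-- **★★★★ THE K1-KEYED EDITION: `B16.Thm1Printed (datumOfRecord₁₃SepCoPH F N θ h).C` for a Gaussian-class `θ` with the separated-range key, the run-guard binder DROPPED
in favour of the bg facts of the windowed runs** (`datumOfRecord₁₃SepCoPH_eq_coPH`, `rfl`).  Same displayed rows. [cite: Balaban1988Convergent, Thm 1 p.262, Theorem p.245, §3 p.279, (0.2) p.244, (2.28) p.259; Balaban1989LargeFieldII, Thm 1 p.355; Balaban1989LargeFieldI, (0.3)–(0.4) p.176] -/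
theorem thm1Printed_datumOfRecord₁₃SepCoPH_of_gaussCert_of_supplierBorel_of_bgFacts_of_powM
    (hζ : ∀ (p : B12.RunParams) (n : ℕ) (Ω Λ : ℕ → Set (Site (F.P p.K) 0)), (θ.Zh p n Ω Λ).ζ0 = (ZhPinOfRecord₁₃ θ.toStage13Params p Ω Λ).ζ0)
    (hq : ∀ (p : B12.RunParams) (n : ℕ) (Ω Λ : ℕ → Set (Site (F.P p.K) 0)) (j : ℕ) (Λ' : Set (Site (F.P p.K) 0)) (ω : MultiCfg (F.P p.K) (SU N) (FluctV N)),
      (θ.Zh p n Ω Λ).quad j Λ' ω = ∑ b ∈ (Set.toFinite (bondsIn j (Λ'ᶜ ∩ Ω (j + 1)))).toFinset, ‖(ω j).2 b‖ ^ 2)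
    (h : θ.Provisos₁₃SepCoPH F N) (hsel : θ.ppSel = ppSelLiveOfRecord F N θ.ν θ.τ9 (EOfRecord₁₃ F N θ.toStage13Params) (wOfRecord₉ F N θ.toStage9Params))
    (hθ : θ.Admissible F N) (hκ : 0 ≤ θ.s2.lf.κ) (hE₀ : 0 ≤ θ.s2.lf.E₀) (hB₀ : 0 ≤ θ.s2.lf.B₀)
    (hM₁ : 0 < θ.ν.M₁) (hle : θ.ν.M₁ ≤ θ.τ9.M) (hcR : 2 ≤ θ.s2.cR) {γ : ℝ} (hγ : 0 < γ)
    (hbgs : ∀ P : B12.RunParams, Step.InInterval γ P.K (gOfRecord₁₃ F N θ.toStage13Params P) → ∀ k, k ≤ P.K →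
      BgProvisoΛ F N P.K (settingOfRecord₁₃ F N θ.toStage13Params P) (θ.Rz P.K) θ.τ9.M k (suppOfRecord₁₃SepCoP F N θ.toStage13Params P k)
        (UbgOfRecord₁₃CoP F N θ.toStage13Params P k))
    (hdiv : F.L * θ.ν.M₂ ∣ θ.τ9.M) {a : ℕ} (hMa : θ.τ9.M = F.L ^ a)
    (h3 : ∀ P : B12.RunParams, Step.InInterval γ P.K (gOfRecord₁₃ F N θ.toStage13Params P) → ∀ j, 1 ≤ j → j ≤ P.K →
      3 * side (F.P P.K).L θ.ν.M₁ j ≤ cubeSide (F.P P.K).L θ.ν.M₂ (RkOfRecord (F.P P.K).L θ.ν.r (gOfRecord₁₃ F N θ.toStage13Params P j)) j)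
    (hR : ∀ P : B12.RunParams, Step.InInterval γ P.K (gOfRecord₁₃ F N θ.toStage13Params P) → ∀ j, 1 ≤ j → j ≤ P.K →
      (F.P P.K).L ^ j + (((F.P P.K).d + 4) * (F.P P.K).L + 2) * (∑ l ∈ Finset.range j, (F.P P.K).L ^ l) + 2 ≤
        cubeSide (F.P P.K).L θ.ν.M₂ (RkOfRecord (F.P P.K).L θ.ν.r (gOfRecord₁₃ F N θ.toStage13Params P j)) j)
    (hε : ∀ P : B12.RunParams, Step.InInterval γ P.K (gOfRecord₁₃ F N θ.toStage13Params P) → ∀ j, 1 ≤ j → j ≤ P.K →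
      0 < epsOfRecord θ.ν (gOfRecord₁₃ F N θ.toStage13Params P) j)
    (hε3 : ∀ P : B12.RunParams, Step.InInterval γ P.K (gOfRecord₁₃ F N θ.toStage13Params P) → ∀ j, 1 ≤ j → j ≤ P.K →
      (143 * (((((F.P P.K).d + 4 : ℕ) : ℝ)) ^ 2 / 4) ^ 2) * epsOfRecord θ.ν (gOfRecord₁₃ F N θ.toStage13Params P) j ≤ 1 / 3)
    (hε2 : ∀ P : B12.RunParams, Step.InInterval γ P.K (gOfRecord₁₃ F N θ.toStage13Params P) → ∀ j, 1 ≤ j → j ≤ P.K →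
      2 * epsOfRecord θ.ν (gOfRecord₁₃ F N θ.toStage13Params P) j ≤ 2 * ExpMeanLog.deltaSU (Fin N) / ((((F.P P.K).d + 4) * (F.P P.K).L : ℕ) : ℝ) ^ 2)
    (hsolv : ∀ P : B12.RunParams, Step.InInterval γ P.K (gOfRecord₁₃ F N θ.toStage13Params P) → ∀ j, 1 ≤ j → j ≤ P.K →
      ∀ (s : SeqOfRecord F θ.ν θ.τ9.M (gOfRecord₁₃ F N θ.toStage13Params P) P.K j) (V : GaugeField (F.P P.K) j (SU N)),
      chiSeqOfRecord F N θ.ν θ.τ9.M (gOfRecord₁₃ F N θ.toStage13Params P) P.K j s V ≠ 0 →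
      ∀ a ∈ cubesIn (fun a : ↥(cubeIndices (F.P P.K) (cubeSide (F.P P.K).L θ.ν.M₂ (RkOfRecord (F.P P.K).L θ.ν.r (gOfRecord₁₃ F N θ.toStage13Params P j)) j)) =>
          cubeEnl (F.P P.K) (cubeSide (F.P P.K).L θ.ν.M₂ (RkOfRecord (F.P P.K).L θ.ν.r (gOfRecord₁₃ F N θ.toStage13Params P j)) j) a 0) (s.Ω j),
        ∃ U₀, IsMinimizer (avOfRecord F N P.K) {U | PlaqSmall (θ.ν.εreg * (F.P P.K).eta j ^ 2) U}
          (Bj θ.ν.M₁ (cubeEnl (F.P P.K) (cubeSide (F.P P.K).L θ.ν.M₂ (RkOfRecord (F.P P.K).L θ.ν.r (gOfRecord₁₃ F N θ.toStage13Params P j)) j) a 4) j)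
          (avgFamily (avOfRecord F N P.K) (qsstarGIter0 j V)) U₀)
    (σ : (P : B12.RunParams) → Sect3Supplier θ P) (hσ : ∀ P : B12.RunParams, Step.InInterval γ P.K (gOfRecord₁₃ F N θ.toStage13Params P) → SupplierObligations θ P (σ P))
    (hσB : ∀ P : B12.RunParams, Step.InInterval γ P.K (gOfRecord₁₃ F N θ.toStage13Params P) → SupplierBorel θ P (σ P)) :
    B16.Thm1Printed (datumOfRecord₁₃SepCoPH F N θ h).C :=
  thm1Printed_datumOfRecord₁₃CoPH_of_gaussCert_of_supplierBorel_of_bgFacts_of_powM θ hζ hq h.toCore hsel hθ hκ hE₀ hB₀ hM₁ hle hcR hγ hbgs hdiv hMa h3 hR hε hε3 hε2 hsolv σ hσ hσB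

/-- **★★★★★ N11's PRINTED OUTPUT AT THE K1-KEYED DATUM OF THE NAMED GAUSSIAN CERTIFICATE `gaussPinH θ` WITH THE RUN-GUARD BINDER DROPPED** — B §5's ★★★★★ with
`hPC` ↦ the bg facts `hbgs` (+ `L·M₂ ∣ M`, `M = L^a`); NO class hypothesis (`gaussPinH_ζ0 ∕ gaussPinH_quad` `rfl`, key transferred by `provisos₁₃SepCoPH_gaussPinH`); the bg facts,
stated over `θ`'s Stage-13 letters, serve the certificate verbatim (it shares `θ.toStage13RParams`).  THE HONEST STATE OF N11's PRINTED FACE ON THE `SupplierBorel` ROAD AFTER THE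
HOLE BELOW THE FLOOR: every displayed binder is now satisfiable in kind (the bg family by dag-n11-w5 p623895 §6 at K1's witness H-extensions with `j + 1 ≤ m`; the supplier = [III] §3,
XL; K0's solvability = K0⁷'s rows; `2 ≤ cR` at a cR-lettered member, dag-n11-w3 g4). [cite: Balaban1988Convergent, Thm 1 p.262, Theorem p.245, §3 p.279, (0.2) p.244, (2.28) p.259, (3.16) p.268, (3.24)–(3.25) p.270; Balaban1989LargeFieldII, Thm 1 p.355; Balaban1989LargeFieldI, (0.3)–(0.4) p.176, p.177 (i)–(ii); Balaban1985Variational, Thm 1 (7)–(8) pp.278–279] -/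
theorem thm1Printed_datumOfRecord₁₃SepCoPH_gaussPinH_of_supplierBorel_of_bgFacts_of_powM
    (h : θ.Provisos₁₃SepCoPH F N) (hsel : θ.ppSel = ppSelLiveOfRecord F N θ.ν θ.τ9 (EOfRecord₁₃ F N θ.toStage13Params) (wOfRecord₉ F N θ.toStage9Params))
    (hθ : θ.Admissible F N) (hκ : 0 ≤ θ.s2.lf.κ) (hE₀ : 0 ≤ θ.s2.lf.E₀) (hB₀ : 0 ≤ θ.s2.lf.B₀)
    (hM₁ : 0 < θ.ν.M₁) (hle : θ.ν.M₁ ≤ θ.τ9.M) (hcR : 2 ≤ θ.s2.cR) {γ : ℝ} (hγ : 0 < γ)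
    (hbgs : ∀ P : B12.RunParams, Step.InInterval γ P.K (gOfRecord₁₃ F N θ.toStage13Params P) → ∀ k, k ≤ P.K →
      BgProvisoΛ F N P.K (settingOfRecord₁₃ F N θ.toStage13Params P) (θ.Rz P.K) θ.τ9.M k (suppOfRecord₁₃SepCoP F N θ.toStage13Params P k)
        (UbgOfRecord₁₃CoP F N θ.toStage13Params P k))
    (hdiv : F.L * θ.ν.M₂ ∣ θ.τ9.M) {a : ℕ} (hMa : θ.τ9.M = F.L ^ a)
    (h3 : ∀ P : B12.RunParams, Step.InInterval γ P.K (gOfRecord₁₃ F N θ.toStage13Params P) → ∀ j, 1 ≤ j → j ≤ P.K →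
      3 * side (F.P P.K).L θ.toStage13Params.ν.M₁ j ≤ cubeSide (F.P P.K).L θ.toStage13Params.ν.M₂ (RkOfRecord (F.P P.K).L θ.toStage13Params.ν.r (gOfRecord₁₃ F N θ.toStage13Params P j)) j)
    (hR : ∀ P : B12.RunParams, Step.InInterval γ P.K (gOfRecord₁₃ F N θ.toStage13Params P) → ∀ j, 1 ≤ j → j ≤ P.K →
      (F.P P.K).L ^ j + (((F.P P.K).d + 4) * (F.P P.K).L + 2) * (∑ l ∈ Finset.range j, (F.P P.K).L ^ l) + 2 ≤
        cubeSide (F.P P.K).L θ.toStage13Params.ν.M₂ (RkOfRecord (F.P P.K).L θ.toStage13Params.ν.r (gOfRecord₁₃ F N θ.toStage13Params P j)) j)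
    (hε : ∀ P : B12.RunParams, Step.InInterval γ P.K (gOfRecord₁₃ F N θ.toStage13Params P) → ∀ j, 1 ≤ j → j ≤ P.K →
      0 < epsOfRecord θ.toStage13Params.ν (gOfRecord₁₃ F N θ.toStage13Params P) j)
    (hε3 : ∀ P : B12.RunParams, Step.InInterval γ P.K (gOfRecord₁₃ F N θ.toStage13Params P) → ∀ j, 1 ≤ j → j ≤ P.K →
      (143 * (((((F.P P.K).d + 4 : ℕ) : ℝ)) ^ 2 / 4) ^ 2) * epsOfRecord θ.toStage13Params.ν (gOfRecord₁₃ F N θ.toStage13Params P) j ≤ 1 / 3)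
    (hε2 : ∀ P : B12.RunParams, Step.InInterval γ P.K (gOfRecord₁₃ F N θ.toStage13Params P) → ∀ j, 1 ≤ j → j ≤ P.K →
      2 * epsOfRecord θ.toStage13Params.ν (gOfRecord₁₃ F N θ.toStage13Params P) j ≤ 2 * ExpMeanLog.deltaSU (Fin N) / ((((F.P P.K).d + 4) * (F.P P.K).L : ℕ) : ℝ) ^ 2)
    (hsolv : ∀ P : B12.RunParams, Step.InInterval γ P.K (gOfRecord₁₃ F N θ.toStage13Params P) → ∀ j, 1 ≤ j → j ≤ P.K →
      ∀ (s : SeqOfRecord F θ.toStage13Params.ν θ.toStage13Params.τ9.M (gOfRecord₁₃ F N θ.toStage13Params P) P.K j) (V : GaugeField (F.P P.K) j (SU N)),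
      chiSeqOfRecord F N θ.toStage13Params.ν θ.toStage13Params.τ9.M (gOfRecord₁₃ F N θ.toStage13Params P) P.K j s V ≠ 0 →
      ∀ a ∈ cubesIn (fun a : ↥(cubeIndices (F.P P.K) (cubeSide (F.P P.K).L θ.toStage13Params.ν.M₂ (RkOfRecord (F.P P.K).L θ.toStage13Params.ν.r (gOfRecord₁₃ F N θ.toStage13Params P j)) j)) =>
          cubeEnl (F.P P.K) (cubeSide (F.P P.K).L θ.toStage13Params.ν.M₂ (RkOfRecord (F.P P.K).L θ.toStage13Params.ν.r (gOfRecord₁₃ F N θ.toStage13Params P j)) j) a 0) (s.Ω j),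
        ∃ U₀, IsMinimizer (avOfRecord F N P.K) {U | PlaqSmall (θ.toStage13Params.ν.εreg * (F.P P.K).eta j ^ 2) U}
          (Bj θ.toStage13Params.ν.M₁ (cubeEnl (F.P P.K) (cubeSide (F.P P.K).L θ.toStage13Params.ν.M₂ (RkOfRecord (F.P P.K).L θ.toStage13Params.ν.r (gOfRecord₁₃ F N θ.toStage13Params P j)) j) a 4) j)
          (avgFamily (avOfRecord F N P.K) (qsstarGIter0 j V)) U₀)
    (σ : (P : B12.RunParams) → Sect3Supplier (gaussPinH θ) P)
    (hσ : ∀ P : B12.RunParams, Step.InInterval γ P.K (gOfRecord₁₃ F N θ.toStage13Params P) → SupplierObligations (gaussPinH θ) P (σ P))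
    (hσB : ∀ P : B12.RunParams, Step.InInterval γ P.K (gOfRecord₁₃ F N θ.toStage13Params P) → SupplierBorel (gaussPinH θ) P (σ P)) :
    B16.Thm1Printed (datumOfRecord₁₃SepCoPH F N (gaussPinH θ) (provisos₁₃SepCoPH_gaussPinH h)).C :=
  thm1Printed_datumOfRecord₁₃SepCoPH_of_gaussCert_of_supplierBorel_of_bgFacts_of_powM (gaussPinH θ) (gaussPinH_ζ0 θ) (gaussPinH_quad θ) (provisos₁₃SepCoPH_gaussPinH h) hsel
    hθ hκ hE₀ hB₀ hM₁ hle hcR hγ hbgs hdiv hMa h3 hR hε hε3 hε2 hsolv σ hσ hσB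

end Printed

end Summit.QuantumFields.YangMills.Theorems.BalabanUVNodesN11Sect3SupplyChainBorelBThm1PrintedOfBgFacts

end
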